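import Mathlib
import HarnessLib
import Summits.QuantumFields.YangMills.Theses.ScalingWindowSplit
import Summits.QuantumFields.YangMills.Theorems.ScalingWindowSplitExistenceLegFromLatticeR
import Summits.QuantumFields.YangMills.Theorems.SelfNormalisedMomentBounds.Negative.SelfNormalisedMomentBoundsFalseOfTwoRateWindowScheme
import Summits.QuantumFields.YangMills.Theorems.ScalingWindowSplitSelfNormalisedMomentBoundsROfClusterBound

/-!
# `SelfNormalisedMomentBoundsR` (stmt-QuantumFields-18014) — negative lemma: ONE COVARIANCE SCALE

Negative lemma (line lead `Sketch`, gen 1) for crux U_R = `ScalingWindowSplit.SelfNormalisedMomentBoundsR` of route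
`ScalingWindowSplit`, BY NAME, modulo the hypothesis `TwoScaleHonestWindowScheme` (`H₂`).

**Finding (kernel-checked).**  U_R quantifies over ALL compact `G`.  Already at orders `n ≤ 2` it forces a `k`-UNIFORM
TWO-POINT ENVELOPE on the bare truncated plaquette two-point functions along every admissible datum
(`scale_rigidity_of_selfNormalisedMomentBoundsR`): there are ONE Schwartz order `s` and ONE constant `B` such that,
eventually in `k`, for ALL real tests `v, w` with disjoint supports,
`|T⁰_k(v, w)| ≤ B (|v|_s + 1)(|w|_s + 1) · T⁰_k(u, θu)` — no disjoint pair, however SMALL its supports and however CLOSE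
they come, may be correlated above the reference pair by more than its Schwartz size.  Hence
(`SelfNormalisedMomentBoundsR_false_of_TwoScaleHonestWindowScheme`) U_R is false as soon as ONE admissible datum carries a
second covariance scale (`TwoScaleHonestWindowScheme`).  The strategist's fixed-pair hypothesis `TwoRateHonestWindowScheme`
(census `MaskedSectorObstruction.lean`, Part A) is the special case `w = θv`, `v` fixed (`twoScale_of_twoRate`), and it is in
turn a `TwoRateWindowScheme` of the held rev-5 lemma (`twoRateWindowScheme_of_honest`).  The registered physics stub of line
`Sketch` inherits the refutation through the landed `selfNormalisedMomentBoundsR_of_clusterBound`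
(`clusterBound_false_of_TwoScaleHonestWindowScheme`).

**Why `H₂` is expected (and why it is not constructible here).**  Intended inhabitant: the MASKED PRODUCT GROUP
`G = U(1) × SU(2)`, `r = e^{iθ} ⊕ V` (faithful, 3-dimensional).  Wilson's measure factorises and the plaquette field is the
SUM of two independent sectors, so `T⁰ = T⁰_{U(1)} + T⁰_{SU(2)}`.  Along `β_k ↑ ∞` put the non-abelian confinement scale
LOGARITHMICALLY UNDER the abelian power law: `a_k := ρ_k / ξ_{SU(2)}(2β_k)` with `ρ_k := (log β_k)⁻²`, volumes
`L_k := ⌈a_k⁻²⌉`.  Then (P1) the photon carries floor and window at any honest bump `u` (`T⁰_{U(1)}(u,θu) ≍ β_k⁻² J(u)`,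
`J` the Maxwell `F²`-covariance), (P2a) the gluon sector is invisible at the reference pair
(`T⁰_{SU(2)}(u,θu) ≲ ρ_k⁻⁸ e^{-2δ_u/ρ_k} = o(β_k⁻²)`: exponential clustering beyond its correlation length), while (P2b) on
a disjoint pair of bumps of width `ρ'_k ≤ ρ_k` at mutual distance `3ρ'_k`, normalised in order `s` (a factor `ρ'^{s}` each),
`|T⁰_{SU(2)}(v_k, w_k)| ≍ ρ'^{2s}_k (g_eff(ρ'_k)/g₀)⁴ · β_k⁻²`-free `= ρ'^{2s}_k g_eff(ρ'_k)⁴ / 16 · β_k^0`, so the ratio to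
`T⁰(u,θu)` is `≍ β_k² g_eff(ρ'_k)⁴ ρ'^{2s}_k → ∞` for EVERY `s` (one-loop: `g_eff(ρ_k)² ≍ 1/(4b₀ log log β_k)`; the `β_k²` is
ASYMPTOTIC FREEDOM — the coupling has RUN by an unbounded factor between `a_k` and `ρ_k`, which no abelian or finite sector can
do: abelian sectors are Gaussian with amplitude `(mβ_k)⁻²` at every scale, finite sectors freeze at rate `e^{-cβ_k}`).
Rigorous status: (P1) is Coulomb-phase control of Wilson-`U(1)₄` plaquette covariances at large `β` in volumes exponential in
`β` (Guth 1980 / Fröhlich–Spencer 1982 technology, not in the tree); (P2a) is the weak-coupling MASS GAP of `SU(2)₄` with the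
asymptotic-freedom bound on the correlation length (Clay); (P2b) is ultraviolet stability with running coupling down to
`g_eff² ≍ 1/log log β` (Bałaban 1985–89 reaches effective actions, not correlators).  Compared with the fixed-pair `H_R`, `H₂`
does NOT need two-sided Ornstein–Zernike asymptotics at `O(log β_k)` correlation lengths — only (P2a) as an upper bound and
(P2b) in the perturbative window.  Not constructible in the tree; no in-tree witness of U_R's hypotheses exists at all
(refuter birth-vetting).

**Repair proposed to the planner (class: misstated — missing side condition).**  U_RS: insert `IsCompactSimpleLieGroup G →`
after the instance binders (the Statement `YangMills` and the consumer `HypercubicLimit` carry it; W₁ supplies data only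
for simple `G`); glue `existenceLegFromLatticeRS` / `closesRS` certified in the census file, and line `Sketch` transfers
verbatim (`Lines/Sketch_RS.lean`: eight landed stubs unchanged, one physics stub `stub_clusterBoundS`).  For simple `G` the
scale-rigidity envelope is EXPECTED (one running coupling: the normalised short pair is `≍ ρ^{2s}(g(ρ)/g(δ_u))⁴ → 0`).

Contents: `scale_rigidity_of_selfNormalisedMomentBoundsR` (U_R ⇒ one covariance scale), `TwoScaleHonestWindowScheme` (`H₂`),
`SelfNormalisedMomentBoundsR_false_of_TwoScaleHonestWindowScheme` (`H₂ → ¬U_R`), `TwoRateHonestWindowScheme` (`H_R`, adapted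
from the strategist's census workfile) with `twoScale_of_twoRate`, `twoRateWindowScheme_of_honest`,
`SelfNormalisedMomentBoundsR_false_of_TwoRateHonestWindowScheme`, and `clusterBound_false_of_TwoScaleHonestWindowScheme`.
No `sorry`; axioms `propext`, `Classical.choice`, `Quot.sound`.  References: Glimm–Jaffe (1987) §6.1, §19.1 (truncated
functions as covariances); Guth (1980), Fröhlich–Spencer (1982); Bałaban (1985–1989); Magnen–Rivasseau–Sénéor (1993).
-/

noncomputable section

open scoped SchwartzMap BigOperators Topology
open MeasureTheory ProbabilityTheory Filter Topology
open Literature.MathematicalPhysics.AQFT Literature.MathematicalPhysics.QuantumLattice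
open Literature.MathematicalPhysics.QuantumFieldTheory Literature.Probability.LatticeModels
open Summit.QuantumFields.YangMills.Cruxes.HypercubicLimit.CouplingResponse
open Summit.QuantumFields.YangMills.Theorems.ScalingWindowSplit (trunc_rescale trunc_eq_covariance)
open Summit.QuantumFields.YangMills.Theorems.SelfNormalisedMomentBounds.Negative (trunc_smul TwoRateWindowScheme)

namespace Summit.QuantumFields.YangMills.Theorems.SelfNormalisedMomentBoundsR.Negative

/-! ## U_R forces ONE covariance scale -/

section ScaleRigidity

variable {G : Type} [Group G] [TopologicalSpace G] [IsTopologicalGroup G] [CompactSpace G]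
  [MeasurableSpace G] [BorelSpace G]

/-- **U_R forces a `k`-uniform two-point envelope (one covariance scale).**  If `SelfNormalisedMomentBoundsR` holds
then, at every admissible datum `(G, r, sch, u, p, M)` of U_R (weak coupling, polynomial volumes, `u` supported at negative
times, floor and window at `u`), there are a Schwartz order `s` and a constant `B` such that EVENTUALLY IN `k`, for ALL real
tests `v, w` with disjoint supports, the bare truncated two-point function of the pair is dominated by the reference one
weighted by the Schwartz sizes: `|T⁰_k(v,w)| ≤ B (|v|_s + 1)(|w|_s + 1) · T⁰_k(u,θu)`.  Proof: the self-normalised scheme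
`canon` has `c'_k² = 1/T⁰_k(u,θu)` on the tail; U_R at orders `1` and `2` (through the landed `uniformMomentBounds_of_planes`)
bounds `|𝔖₂^canon|` and `|𝔖₁^canon|` on normalised disjoint pairs uniformly in `k`, and the seam identity (`trunc_rescale`,
`trunc_smul`) reads `𝔖₂^canon − 𝔖₁^canon 𝔖₁^canon = λλ' T⁰_k(v,w)/T⁰_k(u,θu)` at `(λv, λ'w)`, `λ = (|v|_s+1)⁻¹`,
`λ' = (|w|_s+1)⁻¹`.  The tail is the floor-and-window tail, independent of `(v, w)`. [folklore] -/
theorem scale_rigidity_of_selfNormalisedMomentBoundsR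
    (hU : Summit.QuantumFields.YangMills.Theses.ScalingWindowSplit.SelfNormalisedMomentBoundsR)
    (r : LatticeRep G) (sch : SpeciesScheme (YMSpecies G))
    (u : 𝓢(EuclideanSpace ℝ (Fin 4), ℝ)) (p : ℕ) (M : ℝ) :
    let bare : SpeciesScheme (YMSpecies G) := { sch with c := fun _ _ => 1, m := fun _ _ => 0 }
    let T : 𝓢(EuclideanSpace ℝ (Fin 4), ℝ) → ℕ → ℝ := fun w k =>
      latticeSchwinger r.ρ bare (fun s => s.F) k (1 + 1) (fun _ => r.curvature) ![w, thetaTest 4 w] -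
        latticeSchwinger r.ρ bare (fun s => s.F) k 1 (fun _ => r.curvature) ![w] *
          latticeSchwinger r.ρ bare (fun s => s.F) k 1 (fun _ => r.curvature) ![thetaTest 4 w]
    let T₂ : 𝓢(EuclideanSpace ℝ (Fin 4), ℝ) → 𝓢(EuclideanSpace ℝ (Fin 4), ℝ) → ℕ → ℝ := fun v w k =>
      latticeSchwinger r.ρ bare (fun s => s.F) k (1 + 1) (fun _ => r.curvature) ![v, w] -
        latticeSchwinger r.ρ bare (fun s => s.F) k 1 (fun _ => r.curvature) ![v] *
          latticeSchwinger r.ρ bare (fun s => s.F) k 1 (fun _ => r.curvature) ![w]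
    sch.HasWeakCouplingLimit →
    (∃ N : ℕ, 1 ≤ N ∧ ∀ᶠ k in Filter.atTop, (sch.a k)⁻¹ ≤ (sch.a k * (sch.L k : ℝ)) ^ N) →
    tsupport u ⊆ {y : EuclideanSpace ℝ (Fin 4) | y 0 < 0} →
    (∀ᶠ k in Filter.atTop, (sch.a k) ^ p ≤ T u k ∧ T u k ≤ M * T (timeShiftTest 4 (-1) u) k) →
    ∃ (s : ℕ) (B : ℝ), ∀ᶠ k in Filter.atTop, ∀ v w : 𝓢(EuclideanSpace ℝ (Fin 4), ℝ),
      Disjoint (tsupport v) (tsupport w) →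
        |T₂ v w k| ≤ B * (schwartzNorm s (ofRealTest v) + 1) * (schwartzNorm s (ofRealTest w) + 1) * T u k := by
  intro bare T T₂ hw hpv hu hfw
  -- the self-normalised scheme of U_R
  let canon : SpeciesScheme (YMSpecies G) :=
    { sch with
      c := fun _ k => (Real.sqrt (T u k))⁻¹
      m := fun _ k => ∫ U, r.curvature.F (torusLift (sch.side k) U) ∂(wilsonMeasure r.ρ (sch.β k)) }
  -- U_R at the datum: the (inlined) plane-resolved moment bounds of `canon`, re-folded by `Iff.rfl`
  have hP : UniformMomentBoundsPlanes r canon := hU G r sch u p M hw hpv hu hfw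
  -- planes ⇒ curvature strings (landed)
  obtain ⟨s, C₀, C₁, hb⟩ := uniformMomentBounds_of_planes G r canon hP
  -- the uniform constants
  set A₁ : ℝ := C₀ * C₁ ^ 1 * (Nat.factorial 1 : ℕ) with hA₁
  set A₂ : ℝ := C₀ * C₁ ^ (1 + 1) * (Nat.factorial (1 + 1) : ℕ) with hA₂
  set B₀ : ℝ := A₂ + A₁ * A₁ with hB₀
  refine ⟨s, B₀, hfw.mono fun k hk v w hdisj => ?_⟩
  -- on the tail: `T⁰_k(u,θu) > 0` and `c'_k² = 1/T⁰_k(u,θu)`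
  have hTpos : 0 < T u k := (pow_pos (sch.a_pos k) p).trans_le hk.1
  have hc : canon.c r.curvature k ^ 2 = (T u k)⁻¹ := by
    show ((Real.sqrt (T u k))⁻¹) ^ 2 = (T u k)⁻¹
    rw [inv_pow, Real.sq_sqrt hTpos.le]
  -- the normalised pair
  set N₁ : ℝ := schwartzNorm s (ofRealTest v) with hN₁
  set N₂ : ℝ := schwartzNorm s (ofRealTest w) with hN₂
  have hN₁0 : 0 ≤ N₁ := schwartzNorm_nonneg _ _
  have hN₂0 : 0 ≤ N₂ := schwartzNorm_nonneg _ _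
  have hN₁1 : 0 < N₁ + 1 := by linarith
  have hN₂1 : 0 < N₂ + 1 := by linarith
  set l₁ : ℝ := (N₁ + 1)⁻¹ with hl₁
  set l₂ : ℝ := (N₂ + 1)⁻¹ with hl₂
  have hl₁0 : 0 < l₁ := inv_pos.2 hN₁1
  have hl₂0 : 0 < l₂ := inv_pos.2 hN₂1
  set v₁ : 𝓢(EuclideanSpace ℝ (Fin 4), ℝ) := l₁ • v with hv₁
  set v₂ : 𝓢(EuclideanSpace ℝ (Fin 4), ℝ) := l₂ • w with hv₂
  have hn₁ : schwartzNorm s (ofRealTest v₁) ≤ 1 := by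
    rw [hv₁, schwartzNorm_ofRealTest_smul, abs_of_pos hl₁0, ← hN₁, hl₁]
    rw [inv_mul_le_iff₀ hN₁1]
    linarith
  have hn₂ : schwartzNorm s (ofRealTest v₂) ≤ 1 := by
    rw [hv₂, schwartzNorm_ofRealTest_smul, abs_of_pos hl₂0, ← hN₂, hl₂]
    rw [inv_mul_le_iff₀ hN₂1]
    linarith
  have hd₁₂ : Disjoint (tsupport (v₁ : EuclideanSpace ℝ (Fin 4) → ℝ))
      (tsupport (v₂ : EuclideanSpace ℝ (Fin 4) → ℝ)) :=
    hdisj.mono (tsupport_smul_subset_right (fun _ => l₁) _) (tsupport_smul_subset_right (fun _ => l₂) _)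
  -- U_R at orders two and one
  have h2 := hb (1 + 1) ![v₁, v₂]
    (by
      intro i
      fin_cases i
      · simpa using hn₁
      · simpa using hn₂)
    (by
      intro i j hij
      fin_cases i <;> fin_cases j
      · exact absurd rfl hij
      · simpa using hd₁₂
      · simpa using hd₁₂.symm
      · exact absurd rfl hij) k
  have h1 := hb 1 ![v₁] (by intro i; fin_cases i; simpa using hn₁)
    (by intro i j hij; exact absurd (Subsingleton.elim i j) hij) k
  have h1' := hb 1 ![v₂] (by intro i; fin_cases i; simpa using hn₂)
    (by intro i j hij; exact absurd (Subsingleton.elim i j) hij) k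
  -- the seam: `𝔖₂^canon − 𝔖₁^canon 𝔖₁^canon = c'_k² · l₁ l₂ · T⁰_k(v, w)`
  have hseam :
      latticeSchwinger r.ρ canon (fun s => s.F) k (1 + 1) (fun _ => r.curvature) ![v₁, v₂] -
          latticeSchwinger r.ρ canon (fun s => s.F) k 1 (fun _ => r.curvature) ![v₁] *
            latticeSchwinger r.ρ canon (fun s => s.F) k 1 (fun _ => r.curvature) ![v₂] =
        canon.c r.curvature k ^ 2 * (l₁ * l₂ * T₂ v w k) := by
    rw [trunc_rescale r canon k v₁ v₂, hv₁, hv₂, trunc_smul]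
  have hA₁0 : 0 ≤ A₁ := (abs_nonneg _).trans h1
  -- |𝔖₂ − 𝔖₁𝔖₁| ≤ A₂ + A₁²
  have hkey : |(T u k)⁻¹ * (l₁ * l₂ * T₂ v w k)| ≤ B₀ := by
    rw [← hc, ← hseam]
    refine (abs_sub _ _).trans (add_le_add h2 ?_)
    rw [abs_mul]
    exact mul_le_mul h1 h1' (abs_nonneg _) hA₁0
  have hll : 0 < l₁ * l₂ := mul_pos hl₁0 hl₂0
  rw [abs_mul, abs_mul, abs_of_pos (inv_pos.2 hTpos), abs_of_pos hll] at hkey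
  -- unwind: |T⁰_k(v,w)| ≤ B₀ (N₁+1)(N₂+1) · T⁰_k(u,θu)
  have hprod : 0 ≤ T u k * (N₁ + 1) * (N₂ + 1) :=
    mul_nonneg (mul_nonneg hTpos.le hN₁1.le) hN₂1.le
  calc |T₂ v w k|
        = T u k * (N₁ + 1) * (N₂ + 1) * ((T u k)⁻¹ * (l₁ * l₂ * |T₂ v w k|)) := by
          rw [hl₁, hl₂]
          field_simp
    _ ≤ T u k * (N₁ + 1) * (N₂ + 1) * B₀ := mul_le_mul_of_nonneg_left hkey hprod
    _ = B₀ * (N₁ + 1) * (N₂ + 1) * T u k := by ring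

/-- **U_R forces ONE decorrelation rate** (the fixed-pair form; the strategist's Part A, now a corollary of scale
rigidity): at every admissible datum of U_R and for every real test `v` whose support is disjoint from that of `θv`,
eventually `|T⁰_k(v,θv)| ≤ B · T⁰_k(u,θu)`. [folklore] -/
theorem rate_rigidity_of_selfNormalisedMomentBoundsR
    (hU : Summit.QuantumFields.YangMills.Theses.ScalingWindowSplit.SelfNormalisedMomentBoundsR)
    (r : LatticeRep G) (sch : SpeciesScheme (YMSpecies G))
    (u v : 𝓢(EuclideanSpace ℝ (Fin 4), ℝ)) (p : ℕ) (M : ℝ) :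
    let bare : SpeciesScheme (YMSpecies G) := { sch with c := fun _ _ => 1, m := fun _ _ => 0 }
    let T : 𝓢(EuclideanSpace ℝ (Fin 4), ℝ) → ℕ → ℝ := fun w k =>
      latticeSchwinger r.ρ bare (fun s => s.F) k (1 + 1) (fun _ => r.curvature) ![w, thetaTest 4 w] -
        latticeSchwinger r.ρ bare (fun s => s.F) k 1 (fun _ => r.curvature) ![w] *
          latticeSchwinger r.ρ bare (fun s => s.F) k 1 (fun _ => r.curvature) ![thetaTest 4 w]
    sch.HasWeakCouplingLimit →
    (∃ N : ℕ, 1 ≤ N ∧ ∀ᶠ k in Filter.atTop, (sch.a k)⁻¹ ≤ (sch.a k * (sch.L k : ℝ)) ^ N) →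
    tsupport u ⊆ {y : EuclideanSpace ℝ (Fin 4) | y 0 < 0} →
    (∀ᶠ k in Filter.atTop, (sch.a k) ^ p ≤ T u k ∧ T u k ≤ M * T (timeShiftTest 4 (-1) u) k) →
    Disjoint (tsupport v) (tsupport (thetaTest 4 v)) →
    ∃ B : ℝ, ∀ᶠ k in Filter.atTop, |T v k| ≤ B * T u k := by
  intro bare T hw hpv hu hfw hdisj
  obtain ⟨s, B, hB⟩ := scale_rigidity_of_selfNormalisedMomentBoundsR hU r sch u p M hw hpv hu hfw
  refine ⟨B * (schwartzNorm s (ofRealTest v) + 1) * (schwartzNorm s (ofRealTest (thetaTest 4 v)) + 1),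
    hB.mono fun k hk => ?_⟩
  exact hk v (thetaTest 4 v) hdisj

end ScaleRigidity

/-! ## The hypotheses `H₂` (two covariance scales) and `H_R` (two rates), and the negative lemmas -/

/-- **`H₂` — a TWO-SCALE HONEST-WINDOW SCHEME** (hypothesis of the negative lemma; not constructible in the tree).
Some compact group `G`, faithful `r`, Wilson scheme `sch`, bump `u` SUPPORTED AT NEGATIVE TIMES, `p`, `M` meet EXACTLY the
hypotheses of U_R (weak coupling, polynomial volumes, past support, polynomial floor and window at `u`), and the datum
carries a SECOND COVARIANCE SCALE: for every Schwartz order `s` and every `B`, infinitely often in `k` some pair of real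
tests `v, w` with disjoint supports has `B (|v|_s + 1)(|w|_s + 1) · T⁰_k(u,θu) < |T⁰_k(v, w)|` (the pair may depend on `k`
and `s`: shrinking bumps).  Intended inhabitant (physics-grade, see the module docstring): the MASKED PRODUCT GROUP
`U(1) × SU(2)` with `r = e^{iθ} ⊕ V`, the `SU(2)` confinement scale `ρ_k = (log β_k)⁻²` placed logarithmically under the
abelian power law, and bumps of width `≤ ρ_k` — conditionally on (P1) Coulomb control of Wilson-`U(1)₄`, (P2a) the
weak-coupling mass gap of `SU(2)₄`, (P2b) running-coupling control in the perturbative window.  A HYPOTHESIS of this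
negative lemma (no citation tag on purpose: it is not a literature fact and must stay in this file). -/
def TwoScaleHonestWindowScheme : Prop :=
  ∃ (G : Type) (_ : Group G) (_ : TopologicalSpace G) (_ : IsTopologicalGroup G) (_ : CompactSpace G)
    (_ : MeasurableSpace G) (_ : BorelSpace G) (r : LatticeRep G) (sch : SpeciesScheme (YMSpecies G))
    (u : 𝓢(EuclideanSpace ℝ (Fin 4), ℝ)) (p : ℕ) (M : ℝ),
    let bare : SpeciesScheme (YMSpecies G) := { sch with c := fun _ _ => 1, m := fun _ _ => 0 }
    let T : 𝓢(EuclideanSpace ℝ (Fin 4), ℝ) → ℕ → ℝ := fun w k =>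
      latticeSchwinger r.ρ bare (fun s => s.F) k (1 + 1) (fun _ => r.curvature) ![w, thetaTest 4 w] -
        latticeSchwinger r.ρ bare (fun s => s.F) k 1 (fun _ => r.curvature) ![w] *
          latticeSchwinger r.ρ bare (fun s => s.F) k 1 (fun _ => r.curvature) ![thetaTest 4 w]
    let T₂ : 𝓢(EuclideanSpace ℝ (Fin 4), ℝ) → 𝓢(EuclideanSpace ℝ (Fin 4), ℝ) → ℕ → ℝ := fun v w k =>
      latticeSchwinger r.ρ bare (fun s => s.F) k (1 + 1) (fun _ => r.curvature) ![v, w] -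
        latticeSchwinger r.ρ bare (fun s => s.F) k 1 (fun _ => r.curvature) ![v] *
          latticeSchwinger r.ρ bare (fun s => s.F) k 1 (fun _ => r.curvature) ![w]
    sch.HasWeakCouplingLimit ∧
    (∃ N : ℕ, 1 ≤ N ∧ ∀ᶠ k in Filter.atTop, (sch.a k)⁻¹ ≤ (sch.a k * (sch.L k : ℝ)) ^ N) ∧
    tsupport u ⊆ {y : EuclideanSpace ℝ (Fin 4) | y 0 < 0} ∧
    (∀ᶠ k in Filter.atTop, (sch.a k) ^ p ≤ T u k ∧ T u k ≤ M * T (timeShiftTest 4 (-1) u) k) ∧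
    ∀ (s : ℕ) (B : ℝ), ∃ᶠ k in Filter.atTop, ∃ v w : 𝓢(EuclideanSpace ℝ (Fin 4), ℝ),
      Disjoint (tsupport v) (tsupport w) ∧
        B * (schwartzNorm s (ofRealTest v) + 1) * (schwartzNorm s (ofRealTest w) + 1) * T u k < |T₂ v w k|

/-- **Negative lemma modulo `H₂`: a two-scale honest-window scheme refutes U_R as typed.**
`TwoScaleHonestWindowScheme → ¬ SelfNormalisedMomentBoundsR`: at the datum of `H₂`, U_R's scale rigidity
(`scale_rigidity_of_selfNormalisedMomentBoundsR`) gives `(s, B)` with `|T⁰_k(v,w)| ≤ B(|v|_s+1)(|w|_s+1) T⁰_k(u,θu)` for all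
disjoint pairs eventually, contradicting the second scale at `(s, B)` infinitely often.  Class (on paper): refuted-MISSTATED
— U_R quantifies over ALL compact `G`, the masked product group `U(1) × SU(2)` is the expected inhabitant of `H₂`, and the
repaired statement U_RS adds `IsCompactSimpleLieGroup G →` (which the Statement supplies and no group with an abelian or a
second simple factor meets); the witness pattern misses U_RS (one running coupling). [folklore] -/
theorem SelfNormalisedMomentBoundsR_false_of_TwoScaleHonestWindowScheme :
    TwoScaleHonestWindowScheme →
      ¬ Summit.QuantumFields.YangMills.Theses.ScalingWindowSplit.SelfNormalisedMomentBoundsR := by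
  rintro ⟨G, _, _, _, _, _, _, r, sch, u, p, M, hw, hpv, hu, hfw, hscale⟩ hU
  obtain ⟨s, B, hB⟩ := scale_rigidity_of_selfNormalisedMomentBoundsR hU r sch u p M hw hpv hu hfw
  obtain ⟨k, ⟨v, w, hd, hlt⟩, hle⟩ := ((hscale s B).and_eventually hB).exists
  exact absurd hlt (not_lt.2 (hle v w hd))

/-- **`H_R` — a TWO-RATE HONEST-WINDOW SCHEME** (the strategist's fixed-pair hypothesis, census
`MaskedSectorObstruction.lean` Part A, restated here because crux workfiles are not importable from `Theorems/`): the held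
rev-5 lemma's `TwoRateWindowScheme` WITH the past-support clause of the repaired crux — an admissible datum of U_R and ONE
real test `v` with `tsupport v ∩ tsupport θv = ∅` whose bare truncated reflected two-point function is infinitely often
larger than any multiple of the reference one: `∀ B, ∃ᶠ k, B · T⁰_k(u,θu) < |T⁰_k(v,θv)|`.  Intended inhabitant: the same
masked product group with `v` a FIXED bump at time-distance `d₀ < 1/2` (ratio `≍ β_k^{2-4d₀}(log β_k)⁸`), which needs in
addition two-sided Ornstein–Zernike control of `SU(2)₄` at `O(log β_k)` correlation lengths.  A HYPOTHESIS (no citation tag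
on purpose). -/
def TwoRateHonestWindowScheme : Prop :=
  ∃ (G : Type) (_ : Group G) (_ : TopologicalSpace G) (_ : IsTopologicalGroup G) (_ : CompactSpace G)
    (_ : MeasurableSpace G) (_ : BorelSpace G) (r : LatticeRep G) (sch : SpeciesScheme (YMSpecies G))
    (u v : 𝓢(EuclideanSpace ℝ (Fin 4), ℝ)) (p : ℕ) (M : ℝ),
    let bare : SpeciesScheme (YMSpecies G) := { sch with c := fun _ _ => 1, m := fun _ _ => 0 }
    let T : 𝓢(EuclideanSpace ℝ (Fin 4), ℝ) → ℕ → ℝ := fun w k =>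
      latticeSchwinger r.ρ bare (fun s => s.F) k (1 + 1) (fun _ => r.curvature) ![w, thetaTest 4 w] -
        latticeSchwinger r.ρ bare (fun s => s.F) k 1 (fun _ => r.curvature) ![w] *
          latticeSchwinger r.ρ bare (fun s => s.F) k 1 (fun _ => r.curvature) ![thetaTest 4 w]
    sch.HasWeakCouplingLimit ∧
    (∃ N : ℕ, 1 ≤ N ∧ ∀ᶠ k in Filter.atTop, (sch.a k)⁻¹ ≤ (sch.a k * (sch.L k : ℝ)) ^ N) ∧
    tsupport u ⊆ {y : EuclideanSpace ℝ (Fin 4) | y 0 < 0} ∧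
    (∀ᶠ k in Filter.atTop, (sch.a k) ^ p ≤ T u k ∧ T u k ≤ M * T (timeShiftTest 4 (-1) u) k) ∧
    Disjoint (tsupport v) (tsupport (thetaTest 4 v)) ∧
    ∀ B : ℝ, ∃ᶠ k in Filter.atTop, B * T u k < |T v k|

/-- **`H_R ⊆ H₂`**: a fixed reflected pair with a second RATE is in particular a second covariance SCALE — at order `s`
take the pair `(v, θv)` itself and the multiple `B (|v|_s + 1)(|θv|_s + 1)`. [folklore] -/
theorem twoScale_of_twoRate (h : TwoRateHonestWindowScheme) : TwoScaleHonestWindowScheme := by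
  obtain ⟨G, i₁, i₂, i₃, i₄, i₅, i₆, r, sch, u, v, p, M, hw, hpv, hu, hfw, hdisj, hrate⟩ := h
  refine ⟨G, i₁, i₂, i₃, i₄, i₅, i₆, r, sch, u, p, M, hw, hpv, hu, hfw, fun s B => ?_⟩
  refine (hrate (B * (schwartzNorm s (ofRealTest v) + 1) *
    (schwartzNorm s (ofRealTest (thetaTest 4 v)) + 1))).mono fun k hk => ?_
  exact ⟨v, thetaTest 4 v, hdisj, hk⟩

/-- **`H_R ⊆ H`**: an honest-window two-rate scheme is in particular a two-rate scheme of the held rev-5 lemma's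
hypothesis `TwoRateWindowScheme` (drop the past-support clause) — the rev-6 repair narrowed the class of inhabitants
without emptying it. [folklore] -/
theorem twoRateWindowScheme_of_honest (h : TwoRateHonestWindowScheme) : TwoRateWindowScheme := by
  obtain ⟨G, i₁, i₂, i₃, i₄, i₅, i₆, r, sch, u, v, p, M, hw, hpv, _hu, hfw, hdisj, hrate⟩ := h
  exact ⟨G, i₁, i₂, i₃, i₄, i₅, i₆, r, sch, u, v, p, M, hw, hpv, hfw, hdisj, hrate⟩

/-- **Negative lemma modulo `H_R`** (the strategist's form, now a corollary): a two-rate honest-window scheme refutes U_R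
as typed. [folklore] -/
theorem SelfNormalisedMomentBoundsR_false_of_TwoRateHonestWindowScheme :
    TwoRateHonestWindowScheme →
      ¬ Summit.QuantumFields.YangMills.Theses.ScalingWindowSplit.SelfNormalisedMomentBoundsR :=
  fun h => SelfNormalisedMomentBoundsR_false_of_TwoScaleHonestWindowScheme (twoScale_of_twoRate h)

/-- **The registered physics stub of line `Sketch` inherits the refutation.**  The functional-graph cluster bound for ALL
compact `G` (the registered stub `stub_clusterBound`, stated inline as the hypothesis of the landed
`selfNormalisedMomentBoundsR_of_clusterBound`) implies U_R; hence a two-scale honest-window scheme refutes it — which is why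
the line's honest target after the restate is `stub_clusterBoundS` (simple `G`). [folklore] -/
theorem clusterBound_false_of_TwoScaleHonestWindowScheme (h : TwoScaleHonestWindowScheme) :
    ¬ (∀ (G : Type) [Group G] [TopologicalSpace G] [IsTopologicalGroup G] [CompactSpace G] [MeasurableSpace G]
      [BorelSpace G] (r : LatticeRep G) (sch : SpeciesScheme (YMSpecies G)) (u : 𝓢(EuclideanSpace ℝ (Fin 4), ℝ))
      (p : ℕ) (M : ℝ),
      let bare : SpeciesScheme (YMSpecies G) := { sch with c := fun _ _ => 1, m := fun _ _ => 0 }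
      let T : 𝓢(EuclideanSpace ℝ (Fin 4), ℝ) → ℕ → ℝ := fun w k =>
        latticeSchwinger r.ρ bare (fun s => s.F) k (1 + 1) (fun _ => r.curvature) ![w, thetaTest 4 w] -
          latticeSchwinger r.ρ bare (fun s => s.F) k 1 (fun _ => r.curvature) ![w] *
            latticeSchwinger r.ρ bare (fun s => s.F) k 1 (fun _ => r.curvature) ![thetaTest 4 w]
      let canon : SpeciesScheme (YMSpecies G) :=
        { sch with
          c := fun _ k => (Real.sqrt (T u k))⁻¹
          m := fun _ k => ∫ U, r.curvature.F (torusLift (sch.side k) U) ∂(wilsonMeasure r.ρ (sch.β k)) }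
      sch.HasWeakCouplingLimit →
      (∃ N : ℕ, 1 ≤ N ∧ ∀ᶠ k in atTop, (sch.a k)⁻¹ ≤ (sch.a k * (sch.L k : ℝ)) ^ N) →
      tsupport u ⊆ {y : EuclideanSpace ℝ (Fin 4) | y 0 < 0} →
      (∀ᶠ k in atTop, (sch.a k) ^ p ≤ T u k ∧ T u k ≤ M * T (timeShiftTest 4 (-1) u) k) →
      ∃ (C : ℝ) (k₀ : ℕ), 1 ≤ C ∧ ∀ k : ℕ, k₀ ≤ k →
        ∀ (n : ℕ) (x : Fin n → Site 4) (q : Fin n → Plane), 2 ≤ n → Function.Injective x →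
          (∀ i, x i ∈ box 4 (canon.L k)) →
          |canon.c r.curvature k ^ n *
              ∫ U, ∏ i, ((planeSpecies r (q i)).F (configShift (-(x i)) (torusLift (canon.side k) U)) -
                canon.m r.curvature k / 6) ∂(wilsonAt r canon k)| ≤
            C ^ n * ∑ f : Fin n → Fin n, (if ∀ i, f i ≠ i then
              ∏ i, ((canon.a k * ‖siteToE (fun μ : Fin 4 =>
                ((((x i μ - x (f i) μ : ℤ) : ZMod (canon.side k)).valMinAbs : ℤ)))‖)⁻¹) ^ 4 else 0)) :=
  fun hcb => SelfNormalisedMomentBoundsR_false_of_TwoScaleHonestWindowScheme h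
    (Summit.QuantumFields.YangMills.Theorems.ScalingWindowSplit.SelfNormalisedMomentBoundsR.selfNormalisedMomentBoundsR_of_clusterBound
      hcb)

end Summit.QuantumFields.YangMills.Theorems.SelfNormalisedMomentBoundsR.Negative

end
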